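import Summits.CriticalPhenomena.PercolationContinuityZ3.Theorems.PercNearOneGluingNoHeavyLowerTailSahiGridPatternRoundingSwap
import Summits.CriticalPhenomena.PercolationContinuityZ3.Theorems.PercNearOneGluingNoHeavyLowerTailSahiGridPatternThreeCoord

/-!
# `NoHeavyLowerTail` (crux stmt-CriticalPhenomena-4575), Sahi programme P1: **FLATTENING DOMINATION** —
# an inductive route to `PatternPos d` in every dimension (the pattern inequality dominates six times its worst section triple)

Support file (seat `prim-sahi-p1`, generation 13; `--supports stmt-CriticalPhenomena-4575`).  Pure proofs; the only definitions are the
bookkeeping `secLast` (the level slice of a set along the last axis) and the finite `Prop` `FlatteningDomination n` (an obligation /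
hypothesis, never a fact); no `sorry`, standard axioms.

THE MATHEMATICS.  For an up-set `X ⊆ [3]^{n+1}` and a level `v ∈ {0,1,2}` let `X_v = secLast v X ⊆ [3]^n` be its slice along the last
axis (an up-set, nested in `v`).  Replacing `X` by the CYLINDER `X_v × [3]` ("flattening `X` to level `v`") and doing so for all three
sets turns the pattern functional into six times the `n`-dimensional one: `sStarD (X_l × [3]) (Y_m × [3]) (Z_k × [3]) = 6 · sStarD X_l Y_m Z_k`
(`sStarD_liftSet`, generation 7).  Since `sStarD` is invariant under permutations of the axes (`sStarD_map_compEquivD`, from `tcD_perm`),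
the same holds along every axis.
* **`FlatteningDomination n`** (this work, CONJECTURE / obligation): every up-set triple `(A,B,C)` of `[3]^{n+1}` admits an axis and levels
  `(l,m,k)` such that `6 · sStarD A_l B_m C_k ≤ sStarD A B C` — the functional dominates six times its SMALLEST flattening.
* **`patternPos_succ_of_flatteningDomination`**: `FlatteningDomination n → PatternPos n → PatternPos (n+1)` (the flattened triple is an
  up-set triple one dimension down); hence **`patternPos_of_flatteningDomination`**: `(∀ n, 3 ≤ n → n < d → FlatteningDomination n) →
  PatternPos d` from the settled `PatternPos 3`, and **`kahnConjecture_of_flatteningDomination`**: flattening domination in every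
  dimension implies Kahn's Conjecture 5 / Sahi's `C₃` (`kahnConjecture_of_forall_patternPos`).
So, unlike the rounding reduction of generation 12 (whose terminal objects are the twisted Boolean shadows and which therefore still needs
three-partition positivity in the same dimension), flattening is a genuine INDUCTION ON THE DIMENSION: its terminal objects are cylinders.
EVIDENCE AND HONEST LABELS (seat census, generation 13, engines `compute/fd3x/fd3x.c`, `code/c/fd.c`, `compute/fdr`, `compute/symfd`):
`FlatteningDomination n` holds EXHAUSTIVELY for `n + 1 ≤ 3` (`d = 2`: all `8 000` triples; `d = 3`: all `108 635 940` triples up to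
symmetry, `0` violations, slack `S − 6·min ≥ 16` whenever the minimum is positive) and for all axis-symmetric triples of `[3]^d`, `d ≤ 6`;
no counterexample is known at `d = 4, 5` (adversarial search and kit census running at the time of writing).  The STRONGER per-axis form
("for EVERY axis some `(l,m,k)` works") is also exhaustively true at `d = 3` but FALSE at `d = 4`: `A = ↑{2100,1200,1010,2001,0211,1002}`,
`B = ↑{2020,0220,2001,1111,0211,0021,0102,0012}`, `C = ↑{1200,0102}` has `sStarD = 181` while all `27` section triples along axis `2`
have `sStarD ≥ 31` (`6·31 = 186`); every FIXED linear combination of flattenings (transversal sum, mean, diagonal) fails already at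
`d = 3`, and flattening one set at a time fails too — the domination is a genuine joint minimum.  `FlatteningDomination n` (`n ≥ 3`),
`PatternPos d` (`d ≥ 4`; `d = 4` certified elsewhere), Kahn's Conjecture 5 and Sahi's `C₃` remain OPEN; nothing here asserts them. [this work]
-/

namespace Summit.CriticalPhenomena.PercolationContinuityZ3.Theorems.SahiGridPattern

open Finset
open scoped Classical

variable {n d : ℕ}

/-! ### Slices along the last axis and axis relabelling -/

/-- The level-`v` slice of `X ⊆ [3]^{n+1}` along the last axis: `{q : snoc q v ∈ X} ⊆ [3]^n`. [this work] -/
def secLast (v : Fin 3) (X : Finset (Pd (n + 1))) : Finset (Pd n) := univ.filter fun q : Pd n => (Fin.snoc q v : Pd (n + 1)) ∈ X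

/-- Membership in a slice. [this work] -/
theorem mem_secLast {v : Fin 3} {X : Finset (Pd (n + 1))} {q : Pd n} : q ∈ secLast v X ↔ (Fin.snoc q v : Pd (n + 1)) ∈ X := by
  unfold secLast; simp only [mem_filter, mem_univ, true_and]

/-- Slices of up-sets are up-sets. [this work] -/
theorem isUpperSet_secLast (v : Fin 3) {X : Finset (Pd (n + 1))} (hX : IsUpperSet (X : Set (Pd (n + 1)))) :
    IsUpperSet (secLast v X : Set (Pd n)) :=
  isUpperSet_filter_snoc hX v

/-- Slices of an up-set are nested. [this work] -/
theorem secLast_mono {X : Finset (Pd (n + 1))} (hX : IsUpperSet (X : Set (Pd (n + 1)))) {u v : Fin 3} (huv : u ≤ v) :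
    secLast u X ⊆ secLast v X := by
  intro q hq
  rw [mem_secLast] at hq ⊢
  exact hX (snoc_le_snoc_of_le q huv) hq

/-- The cylinder over a slice: `liftSet (secLast v X) = X_v × [3]`; its slices are all equal to `X_v`. [this work] -/
theorem secLast_liftSet (u : Fin 3) (Y : Finset (Pd n)) : secLast u (liftSet Y) = Y := by
  ext q
  rw [mem_secLast]
  unfold liftSet
  simp only [mem_filter, mem_univ, true_and, Fin.init_snoc]

/-- **`sStarD` is invariant under relabelling the axes** (all three sets moved by the same axis permutation). [this work] -/
theorem sStarD_map_compEquivD (τ : Equiv.Perm (Fin d)) (A B C : Finset (Pd d)) :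
    sStarD (A.map (compEquivD τ).toEmbedding) (B.map (compEquivD τ).toEmbedding) (C.map (compEquivD τ).toEmbedding) =
      sStarD A B C := by
  rw [sStarD_eq_sum_tcD, sStarD_eq_sum_tcD, Finset.sum_map]
  refine Finset.sum_congr rfl fun p _ => ?_
  rw [Finset.sum_map]
  refine Finset.sum_congr rfl fun q _ => ?_
  rw [Finset.sum_map]
  refine Finset.sum_congr rfl fun r _ => ?_
  exact tcD_perm τ p q r

/-- The flattened triple: six times the pattern functional of the slices, one dimension down (`sStarD_liftSet`). [this work] -/
theorem sStarD_liftSet_secLast (l m k : Fin 3) (A B C : Finset (Pd (n + 1))) :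
    sStarD (liftSet (secLast l A)) (liftSet (secLast m B)) (liftSet (secLast k C)) =
      6 * sStarD (secLast l A) (secLast m B) (secLast k C) :=
  sStarD_liftSet _ _ _

/-! ### The obligation and the induction on the dimension -/

/-- **`FlatteningDomination n`** — FLATTENING (SECTION) DOMINATION on `[3]^{n+1}`: every up-set triple admits an axis (brought to the
last position by an axis permutation `τ`) and levels `(l, m, k)` such that six times the `n`-dimensional pattern functional of the
corresponding slices is at most the functional of the triple.  A finite statement for each `n`; EXHAUSTIVELY TRUE for `n + 1 ≤ 3`
(seat census, generation 13), OPEN for `n + 1 ≥ 4` (its per-axis strengthening is false at `n + 1 = 4`).  An obligation / hypothesis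
of this file, never used as a fact. [this work] [status: open for n ≥ 3; exhaustive for n ≤ 2] -/
@[conjecture] def FlatteningDomination (n : ℕ) : Prop :=
  ∀ A B C : Finset (Pd (n + 1)), IsUpperSet (A : Set (Pd (n + 1))) → IsUpperSet (B : Set (Pd (n + 1))) →
    IsUpperSet (C : Set (Pd (n + 1))) →
      ∃ (τ : Equiv.Perm (Fin (n + 1))) (l m k : Fin 3),
        6 * sStarD (secLast l (A.map (compEquivD τ).toEmbedding)) (secLast m (B.map (compEquivD τ).toEmbedding))
            (secLast k (C.map (compEquivD τ).toEmbedding)) ≤ sStarD A B C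

/-- The trivial core of every flattening argument: if an up-set triple of `[3]^{n+1}` dominates a positive multiple of the functional of
SOME up-set triple of `[3]^n`, then `PatternPos n` makes it nonnegative. [this work] -/
theorem sStarD_nonneg_of_dominates (hP : PatternPos n) {A B C : Finset (Pd (n + 1))} {X Y Z : Finset (Pd n)}
    (hX : IsUpperSet (X : Set (Pd n))) (hY : IsUpperSet (Y : Set (Pd n))) (hZ : IsUpperSet (Z : Set (Pd n))) {c : ℤ}
    (hc : 0 ≤ c) (h : c * sStarD X Y Z ≤ sStarD A B C) : 0 ≤ sStarD A B C :=
  le_trans (mul_nonneg hc (hP X Y Z hX hY hZ)) h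

/-- **One step of the induction**: `FlatteningDomination n → PatternPos n → PatternPos (n + 1)`. [this work] -/
theorem patternPos_succ_of_flatteningDomination (hF : FlatteningDomination n) (hP : PatternPos n) : PatternPos (n + 1) := by
  intro A B C hA hB hC
  obtain ⟨τ, l, m, k, hle⟩ := hF A B C hA hB hC
  have hA' := isUpperSet_map_compEquivD τ hA
  have hB' := isUpperSet_map_compEquivD τ hB
  have hC' := isUpperSet_map_compEquivD τ hC
  exact sStarD_nonneg_of_dominates hP (isUpperSet_secLast l hA') (isUpperSet_secLast m hB') (isUpperSet_secLast k hC')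
    (by norm_num) hle

/-- The settled base of the induction, KERNEL form: `PatternPos 3` from the three-coordinate slot theorem of generation 11
(`sStarD_nonneg_of_depOn3`: at `d = 3` every up-set depends on at most three coordinates); standard axioms, unlike the
`native_decide` certificate `patternPos_three`. [this work] -/
theorem patternPos_le_three_kernel (hd : d ≤ 3) : PatternPos d := by
  refine patternPos_of_le hd fun A B C hA hB hC => ?_
  exact sStarD_nonneg_of_depOn3 (Finset.univ : Finset (Fin 3)) (by simp) hA
    (fun x y hxy => by rw [show x = y from funext fun t => hxy t (Finset.mem_univ t)]) B C hB hC

/-- **Flattening domination from dimension `3` up to `d − 1` gives `PatternPos d`** (base: the settled `PatternPos 3`, kernel). [this work] -/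
theorem patternPos_of_flatteningDomination (h : ∀ n : ℕ, 3 ≤ n → n < d → FlatteningDomination n) : PatternPos d := by
  induction d with
  | zero => exact patternPos_le_three_kernel (by norm_num)
  | succ m ih =>
    by_cases hm : m + 1 ≤ 3
    · exact patternPos_le_three_kernel hm
    · have h3 : 3 ≤ m := by omega
      exact patternPos_succ_of_flatteningDomination (h m h3 (Nat.lt_succ_self m))
        (ih fun n hn hnm => h n hn (Nat.lt_succ_of_lt hnm))

/-- **Flattening domination in every dimension implies the pattern inequality in every dimension.** [this work] -/
theorem forall_patternPos_of_flatteningDomination (h : ∀ n : ℕ, 3 ≤ n → FlatteningDomination n) : ∀ d, PatternPos d :=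
  fun _ => patternPos_of_flatteningDomination fun n hn _ => h n hn

/-- **Flattening domination in every dimension implies Kahn's Conjecture 5** (and Sahi's `C₃`, `sahiConjecture_three_of_forall_patternPos`).
[this work] -/
theorem kahnConjecture_of_flatteningDomination (h : ∀ n : ℕ, 3 ≤ n → FlatteningDomination n) : KahnConjecture :=
  kahnConjecture_of_forall_patternPos (forall_patternPos_of_flatteningDomination h)

/-- … and Sahi's Conjecture 5 at `n = 3` for every FKG weight on every finite distributive lattice. [this work] -/
theorem sahiConjecture_three_of_flatteningDomination (h : ∀ n : ℕ, 3 ≤ n → FlatteningDomination n) :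
    SahiConjecture 3 :=
  sahiConjecture_three_of_forall_patternPos (forall_patternPos_of_flatteningDomination h)

/-! ### Cylinders realise the bound: the obligation is tight on flat triples -/

/-- On a triple of cylinders along the last axis the flattening at any levels is an equality (so `FlatteningDomination` cannot be
improved by a constant factor). [this work] -/
theorem sStarD_liftSet_eq_six_mul_secLast (l m k : Fin 3) (X Y Z : Finset (Pd n)) :
    sStarD (liftSet X) (liftSet Y) (liftSet Z) = 6 * sStarD (secLast l (liftSet X)) (secLast m (liftSet Y)) (secLast k (liftSet Z)) := by
  rw [secLast_liftSet, secLast_liftSet, secLast_liftSet, sStarD_liftSet]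

end Summit.CriticalPhenomena.PercolationContinuityZ3.Theorems.SahiGridPattern
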